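import Literature.NumberTheory.EllipticCurves.RationalPointInfiniteOrderCriteria
import HarnessLib

/-!
# `2 ≤ rank_ℤ E(ℚ)` from TWO rational points — a kernel-checkable RANK-TWO certificate
# ("RED-pair": `m`-independence read off at good odd primes through the reduction kernel)

Companion of `RationalPointInfiniteOrderCriteria` (the rank-ONE checkers `NL` / `NRED`), written for
the BSD rank-`≤ 1` residual cell `b2b-bsdres` (lane CLASS-CLOSURE; seat cc-typer-2, typer of record
N10/O7) at the request of instrument builder cc-eng-1 GEN 11 (`class-closure/eng-1/code/mtlam/r2cert.py`,
format "REDm-pair"): the congruence / budget consumers of team n1011 (ROUTE-2 II.9.3 (c), "rank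
partner": `le_lambdaInvariant_of_le_mordellWeilRank`, `partnerPackage … (r₁ := 2)`) carry a binder
`hr₁ : 2 ≤ rank_ℤ E₁(ℚ)` for partner curves of Mordell–Weil rank two; this file reads it off ONE
theorem call per row from a certificate made of rational points and small primes, with NO named fact
beyond the Mordell–Weil theorem already proved in the tree (`module_finite_point_holds`). THEOREMS
ONLY (no definition, no named fact); nothing here asserts anything about a particular curve.

## The certificate and why it works (Silverman AEC VII.2.1, VII.3.1(b), VIII.6.7; Cassels LEC §13)

Data: a prime `m`; two rational points `P, Q` of the globally minimal model `W`; ONE good odd prime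
`ℓ₀` with `m ∤ N_{ℓ₀} := #W̃(𝔽_{ℓ₀})` (so `E(ℚ)` has no point of order `m`: the order of a rational
torsion point divides `N_{ℓ₀}`, tree `addOrderOf_dvd_reductionPointCount`); and for each of the
`m + 1` combinations `v ∈ {P + c Q : 0 ≤ c < m} ∪ {Q}` (representatives of `ℙ¹(𝔽_m)`) a good odd
prime `ℓ` with `m ∣ N_ℓ` and the rational point `(N_ℓ / m) • v = (x, y)` AFFINE with `ℓ ∤ den(x)` —
i.e. `(N_ℓ/m) • v ∉ E₁(ℚ_ℓ)`, the kernel of reduction (`‖x‖_ℓ ≤ 1`). CLAIM: `P, Q` are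
`ℤ`-linearly independent in `E(ℚ)`, hence `2 ≤ rank_ℤ E(ℚ)` (Mordell–Weil). PROOF: if
`s P + t Q = O` with `(s, t) ≠ (0, 0)`, divide by `g = gcd(s, t)`: `v₀ := s₁ P + t₁ Q` is TORSION
(`g v₀ = O`) with `gcd(s₁, t₁) = 1`, so one of `s₁, t₁` is prime to `m` and some representative
`u = P + c Q` or `u = Q` satisfies `u = μ v₀ − m w` with `w ∈ E(ℚ)`. At its certificate prime `ℓ`:
`ord(v₀) ∣ N_ℓ` and `ord(v₀)` is prime to `m` (no rational `m`-torsion), so `ord(v₀) ∣ N_ℓ / m` and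
`(N_ℓ/m) u = −N_ℓ w ∈ E₁(ℚ_ℓ)` (`N_ℓ · E(ℚ_ℓ) ⊆ E₁(ℚ_ℓ)`, AEC VII.2.1, tree
`isInReductionKernel_reductionPointCount_nsmul`) — contradicting `ℓ ∤ den x((N_ℓ/m) u)`. (This is
cc-eng-1's "`v̄ ∉ m Ẽ(𝔽_ℓ)`" in a reduction-MAP-free form: when the `m`-part of `Ẽ(𝔽_ℓ)` is cyclic
the two conditions coincide; the certificate producer simply picks such `ℓ`.) Everything in the
hypotheses is decidable rational / integer arithmetic; the point equalities `(N_ℓ/m) • v = (x, y)`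
are certificate-shaped binders exactly like `NRED`'s `N_p • T ≠ O`.

## Statements
* `two_le_mordellWeilRank_of_linearIndependent` — glue over any field: `Module.Finite ℤ E(F)` and a
  `ℤ`-linearly independent pair give `2 ≤ rank_ℤ`.
* `nsmul_eq_zero_of_isOfFinAddOrder_of_coprime` — a rational torsion point whose order is prime
  to `m` is killed by `N_ℓ / m` at a good odd `ℓ` with `m ∣ N_ℓ`.
* `coprime_addOrderOf_of_not_dvd_reductionPointCount` — `m ∤ N_{ℓ₀}` ⇒ every rational torsion point
  has order prime to `m`.
* `false_of_redCertificate_of_isOfFinAddOrder` — the contradiction at one representative.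
* **`two_le_mordellWeilRank_of_redPair`** — the checker (any prime `m`; representatives
  `P + c • Q`, `c < m`, and `Q`).

## References
* J. H. Silverman, *The Arithmetic of Elliptic Curves*, 2nd ed., GTM 106 (2009): VII.2.1, VII.3.1(b),
  VIII.6.7. [SilvermanAEC2009]
* J. W. S. Cassels, *Lectures on Elliptic Curves*, LMS Student Texts 24 (1991), §13 (descent by a
  prime `m`, `E(ℚ)/mE(ℚ)`). [folklore]
-/

noncomputable section

open scoped Classical

open WeierstrassCurve

namespace Literature.NumberTheory.EllipticCurves

/-! ## §1. Glue: a `ℤ`-independent pair gives rank `≥ 2` -/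

/-- **Two `ℤ`-linearly independent points give `2 ≤ rank_ℤ E(F)`** in a finitely generated `E(F)`
(`LinearIndependent.fintype_card_le_finrank`; `rank_ℤ = finrank_ℤ`). [cite: SilvermanAEC2009, Thm. VIII.6.7] -/
theorem two_le_mordellWeilRank_of_linearIndependent {F : Type*} [Field F]
    (W : WeierstrassCurve F) (hfin : Module.Finite ℤ W.toAffine.Point) {P Q : W.toAffine.Point}
    (h : LinearIndependent ℤ ![P, Q]) : 2 ≤ W.mordellWeilRank := by
  haveI := hfin
  have := h.fintype_card_le_finrank
  simpa [WeierstrassCurve.mordellWeilRank] using this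

/-! ## §2. Torsion bookkeeping at good odd primes -/

section Rat

variable (W : WeierstrassCurve ℚ) [W.IsElliptic] [W.IsGloballyMinimal]

/-- **No rational `m`-torsion from one good odd prime**: if `ℓ₀ ≥ 3`, `ℓ₀ ∤ Δ_W` and
`m ∤ N_{ℓ₀} = #W̃(𝔽_{ℓ₀})` for a prime `m`, then every rational torsion point has order prime to `m`
(a point of order divisible by `m` has a multiple of order exactly `m`, whose order divides `N_{ℓ₀}`,
AEC VII.3.1(b), tree `addOrderOf_dvd_reductionPointCount`). [cite: SilvermanAEC2009, VII.3.1(b)] -/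
theorem coprime_addOrderOf_of_not_dvd_reductionPointCount {m : ℕ} (hm : m.Prime)
    (ℓ₀ : ℕ) [Fact ℓ₀.Prime] (hℓ₀ : 3 ≤ ℓ₀) (hΔ₀ : ¬ (ℓ₀ : ℤ) ∣ minimalDiscriminantInt W)
    (htors : ¬ m ∣ W.reductionPointCount ℓ₀) {v : W.toAffine.Point} (hv : IsOfFinAddOrder v) :
    Nat.Coprime (addOrderOf v) m := by
  rw [Nat.coprime_comm, Nat.Prime.coprime_iff_not_dvd hm]
  intro hdvd
  apply htors
  have hpos : addOrderOf v ≠ 0 := (addOrderOf_pos_iff.mpr hv).ne'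
  -- `w = (ord v / m) • v` has order `m`
  have hw : addOrderOf ((addOrderOf v / m) • v) = m := addOrderOf_nsmul_addOrderOf_sub hpos hdvd
  have hwfin : IsOfFinAddOrder ((addOrderOf v / m) • v) := hv.nsmul
  have h := addOrderOf_dvd_reductionPointCount W ℓ₀ hℓ₀ hΔ₀ hwfin
  rwa [hw] at h

/-- **A rational torsion point with order prime to `m` is killed by `N_ℓ / m`** at a good odd prime
`ℓ` with `m ∣ N_ℓ`: `ord(v) ∣ N_ℓ` (AEC VII.3.1(b)) and `gcd(ord v, m) = 1` give `ord(v) ∣ N_ℓ/m`.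
[cite: SilvermanAEC2009, VII.3.1(b)] -/
theorem nsmul_eq_zero_of_isOfFinAddOrder_of_coprime {m : ℕ}
    (ℓ : ℕ) [Fact ℓ.Prime] (hℓ : 3 ≤ ℓ) (hΔ : ¬ (ℓ : ℤ) ∣ minimalDiscriminantInt W)
    (hmN : m ∣ W.reductionPointCount ℓ) {v : W.toAffine.Point} (hv : IsOfFinAddOrder v)
    (hco : Nat.Coprime (addOrderOf v) m) :
    (W.reductionPointCount ℓ / m) • v = 0 := by
  apply addOrderOf_dvd_iff_nsmul_eq_zero.mp
  have hN := addOrderOf_dvd_reductionPointCount W ℓ hℓ hΔ hv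
  rw [← Nat.mul_div_cancel' hmN] at hN
  exact hco.dvd_of_dvd_mul_left hN

/-- **The contradiction at one representative.** If `v` is a rational TORSION point with order
prime to `m`, `w ∈ E(ℚ)`, `μ ∈ ℤ`, and at a good odd prime `ℓ` with `m ∣ N_ℓ` the point
`(N_ℓ/m) • (μ • v − m • w)` is affine with `ℓ ∤ den(x)`, contradiction: that point equals
`−N_ℓ • w ∈ E₁(ℚ_ℓ)` (AEC VII.2.1), whose affine points have `‖x‖_ℓ > 1`.
[cite: SilvermanAEC2009, Prop. VII.2.1] -/
theorem false_of_redCertificate_of_isOfFinAddOrder {m : ℕ}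
    (ℓ : ℕ) [Fact ℓ.Prime] (hℓ : 3 ≤ ℓ) (hΔ : ¬ (ℓ : ℤ) ∣ minimalDiscriminantInt W)
    (hmN : m ∣ W.reductionPointCount ℓ) {v : W.toAffine.Point} (hv : IsOfFinAddOrder v)
    (hco : Nat.Coprime (addOrderOf v) m) (w : W.toAffine.Point) (μ : ℤ)
    {x y : ℚ} (h : W.toAffine.Nonsingular x y)
    (heq : (W.reductionPointCount ℓ / m) • (μ • v - (m : ℤ) • w) = .some x y h)
    (hden : ¬ ℓ ∣ x.den) :
    False := by
  have hkill := nsmul_eq_zero_of_isOfFinAddOrder_of_coprime W ℓ hℓ hΔ hmN hv hco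
  -- `(N/m) • (μ • v − m • w) = −(N • w)`
  have h1 : (W.reductionPointCount ℓ / m) • ((m : ℤ) • w) = W.reductionPointCount ℓ • w := by
    rw [natCast_zsmul, ← mul_nsmul', Nat.div_mul_cancel hmN]
  have hcalc : (W.reductionPointCount ℓ / m) • (μ • v - (m : ℤ) • w) =
      -(W.reductionPointCount ℓ • w) := by
    rw [nsmul_sub, smul_comm (W.reductionPointCount ℓ / m) μ v, hkill, zsmul_zero, zero_sub, h1]
  rw [hcalc] at heq
  -- the `ℓ`-adic point `−N • w = N • (−w)` is in the kernel of reduction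
  have hker := W.isInReductionKernel_reductionPointCount_nsmul ℓ hΔ (W.toPadicPoint ℓ (-w))
  rw [← map_nsmul, neg_nsmul, heq, toPadicPoint_some, isInReductionKernel_some] at hker
  exact absurd (Padic.norm_rat_le_one hden) (not_le.mpr hker)

/-! ## §3. The checker -/

/-- **`2 ≤ rank_ℤ E(ℚ)` from a RED-pair certificate.** `W/ℚ` globally minimal elliptic, `m` a prime;
`ℓ₀ ≥ 3` a good prime with `m ∤ #W̃(𝔽_{ℓ₀})` (no rational `m`-torsion); `P, Q ∈ E(ℚ)`; for every
`c < m` a good odd prime `ℓ` with `m ∣ N_ℓ` at which `(N_ℓ/m) • (P + c • Q)` is an affine point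
`(x, y)` with `ℓ ∤ den(x)`, and the same for `Q`. Then `P, Q` are `ℤ`-independent and
`2 ≤ rank_ℤ E(ℚ)`. One theorem call per row; every hypothesis is rational / integer arithmetic on the
certificate (cc-eng-1's `r2cert` format "REDm-pair", kernel form). [cite: SilvermanAEC2009, VII.2.1, VII.3.1(b), Thm. VIII.6.7] -/
theorem two_le_mordellWeilRank_of_redPair {m : ℕ} (hm : m.Prime)
    (ℓ₀ : ℕ) [Fact ℓ₀.Prime] (hℓ₀ : 3 ≤ ℓ₀) (hΔ₀ : ¬ (ℓ₀ : ℤ) ∣ minimalDiscriminantInt W)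
    (htors : ¬ m ∣ W.reductionPointCount ℓ₀) (P Q : W.toAffine.Point)
    (hcP : ∀ c : ℕ, c < m → ∃ (ℓ : ℕ) (_ : Fact ℓ.Prime), 3 ≤ ℓ ∧
      ¬ (ℓ : ℤ) ∣ minimalDiscriminantInt W ∧ m ∣ W.reductionPointCount ℓ ∧
      ∃ (x y : ℚ) (h : W.toAffine.Nonsingular x y),
        (W.reductionPointCount ℓ / m) • (P + c • Q) = .some x y h ∧ ¬ ℓ ∣ x.den)
    (hcQ : ∃ (ℓ : ℕ) (_ : Fact ℓ.Prime), 3 ≤ ℓ ∧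
      ¬ (ℓ : ℤ) ∣ minimalDiscriminantInt W ∧ m ∣ W.reductionPointCount ℓ ∧
      ∃ (x y : ℚ) (h : W.toAffine.Nonsingular x y),
        (W.reductionPointCount ℓ / m) • Q = .some x y h ∧ ¬ ℓ ∣ x.den) :
    2 ≤ W.mordellWeilRank := by
  -- the group law on `E(ℚ)` is stated in the tree glue for the classical `DecidableEq ℚ` instance
  -- and here for `instDecidableEqRat`; the instances are equal (`Subsingleton`): `convert`.
  refine two_le_mordellWeilRank_of_linearIndependent W W.module_finite_point_holds
    (P := P) (Q := Q) ?_
  suffices key : LinearIndependent ℤ ![P, Q] by convert key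
  refine LinearIndependent.pair_iff.mpr fun s t hst => ?_
  by_contra hne
  have hmz : (m : ℤ) ≠ 0 := by exact_mod_cast hm.ne_zero
  have hm0 : (0 : ℤ) < m := by exact_mod_cast hm.pos
  have hmP : Prime (m : ℤ) := Nat.prime_iff_prime_int.mp hm
  -- primitive part of `(s, t)`
  have hg : 0 < Int.gcd s t := by
    rcases not_and_or.mp hne with hs0 | ht0
    · exact Int.gcd_pos_of_ne_zero_left t hs0
    · exact Int.gcd_pos_of_ne_zero_right s ht0
  obtain ⟨s₁, t₁, hco1, hs, ht⟩ := Int.exists_gcd_one hg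
  set g : ℕ := Int.gcd s t
  set v : W.toAffine.Point := s₁ • P + t₁ • Q with hvdef
  -- `g • v = 0`, so `v` is torsion, with order prime to `m`
  have hgv : (g : ℤ) • v = 0 := by
    have : (g : ℤ) • v = s • P + t • Q := by rw [hvdef, hs, ht]; module
    rw [this, hst]
  have hv : IsOfFinAddOrder v :=
    isOfFinAddOrder_iff_zsmul_eq_zero.mpr ⟨g, by exact_mod_cast hg.ne', hgv⟩
  have hvco : Nat.Coprime (addOrderOf v) m :=
    coprime_addOrderOf_of_not_dvd_reductionPointCount W hm ℓ₀ hℓ₀ hΔ₀ htors hv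
  have hco1' : IsCoprime s₁ t₁ := Int.isCoprime_iff_gcd_eq_one.mpr hco1
  by_cases hms : (m : ℤ) ∣ s₁
  · -- `m ∣ s₁`, hence `m ∤ t₁`: the representative is `Q = μ • v − m • w`
    obtain ⟨k, hk⟩ := hms
    have ht1 : IsCoprime t₁ (m : ℤ) := by
      rw [hk] at hco1'
      exact (IsCoprime.of_mul_left_left hco1').symm
    obtain ⟨μ, β, hμ⟩ := ht1
    obtain ⟨ℓ, hF, hℓ3, hΔ, hmN, x, y, h, heq, hden⟩ := hcQ
    have hrep : μ • v - (m : ℤ) • ((μ * k) • P - β • Q) = Q := by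
      rw [hvdef, hk]
      match_scalars
      · ring
      · linear_combination hμ
    rw [← hrep] at heq
    exact false_of_redCertificate_of_isOfFinAddOrder W ℓ hℓ3 hΔ hmN hv hvco _ μ h heq hden
  · -- `m ∤ s₁`: the representative is `P + c • Q = μ • v − m • w`, `c = (μ t₁) mod m`
    have hs1 : IsCoprime s₁ (m : ℤ) := (hmP.irreducible.coprime_iff_not_dvd.mpr hms).symm
    obtain ⟨μ, β, hμ⟩ := hs1
    have hc₀ : μ * t₁ = (m : ℤ) * (μ * t₁ / m) + μ * t₁ % m := (Int.mul_ediv_add_emod _ _).symm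
    have hnn : 0 ≤ μ * t₁ % m := Int.emod_nonneg _ hmz
    have hlt : μ * t₁ % m < m := Int.emod_lt_of_pos _ hm0
    have hcz : μ * t₁ % m = ((μ * t₁ % m).toNat : ℕ) := (Int.toNat_of_nonneg hnn).symm
    obtain ⟨ℓ, hF, hℓ3, hΔ, hmN, x, y, h, heq, hden⟩ := hcP (μ * t₁ % m).toNat (by omega)
    have hrep : μ • v - (m : ℤ) • ((-β) • P + (μ * t₁ / m) • Q) = P + (μ * t₁ % m).toNat • Q := by
      rw [hvdef, ← natCast_zsmul Q]
      match_scalars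
      · linear_combination hμ
      · linear_combination hc₀ + hcz
    rw [← hrep] at heq
    exact false_of_redCertificate_of_isOfFinAddOrder W ℓ hℓ3 hΔ hmN hv hvco _ μ h heq hden

end Rat

end Literature.NumberTheory.EllipticCurves

end
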